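import Literature.MathematicalPhysics.QuantumLattice.FermionGroundStatesMinimiseMeanEnergy
import Literature.MathematicalPhysics.QuantumLattice.HubbardNNNHoppingCorrelatorWindowCertificate
import HarnessLib

/-!
# `t–t'` Hubbard model: the window certificate read in an ABSTRACT infinite-volume state, and in
# every translation-invariant ground state of `H(t,t',U) - μN`

Topic `Literature/MathematicalPhysics/QuantumLattice`; namespace
`Literature.MathematicalPhysics.QuantumLattice` (the file path). The tree reads the window certificate
identity of `HubbardNNNHoppingCorrelatorWindowCertificate.lean` (objective `X ∈ 𝔄_{Λ'}`, density terms,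
energy-constraint term `κ(u·1 − Γ E^{tt'}_Φ)`, SOS Gram part, `[H^{tt'}_{Λ'}, ΓB]` rows, affine-`D₄`/
translation defects, charged words, anti-Hermitian parts, residual words) in the symmetrised vector
states of finite tori and then in TORUS-LIMIT ground states
(`InfVolFermionState.IsTorusLimitOf.re_expect_ge_of_window_certificate_TT'_ineq`,
`HubbardNNNHoppingTorusLimitCorrelator.lean`). This file reads the SAME identity directly in an
arbitrary infinite-volume state `ω : InfVolFermionState 2`, term by term:

* `InfVolFermionState.re_expect_ge_of_window_certificate_TT'_ineq_of_nulls` — if `ω` kills the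
  equation-of-motion rows (`ω(H^{tt'}_{Λ'} ΓB_k − ΓB_k H^{tt'}_{Λ'}) = 0`), the symmetry defects
  (`ω(Γ(γ_l Λ + w_l ← Λ) Y_l − Γ Y_l) = 0`) and the charged words (`ω(W_j) = 0`) of the certificate,
  then `c − Σₖ‖aₖ‖ + Σ_σ μ_σ (Re ω(n_{0σ}) − ν) + κ (u − e^{tt'}(ω)) ≤ Re ω_{Λ'}(X)` — positivity on
  the Gram part (`StateRelaxation.map_gramForm_nonneg`), Hermiticity on the anti-Hermitian parts,
  contractivity on the residual words (`‖ω(W)‖ ≤ ‖W‖ ≤ 1`), and `ω_{Λ'}(Γ E_Φ) = e^{tt'}(ω)` by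
  compatibility; no translation invariance, no ground-state property and no energy bound is assumed
  (the `κ`-term is kept explicit);
* `InfVolFermionState.IsTranslationInvariant.expect_translationDefect_eq_zero` — a translation-
  invariant `ω` kills the translation defects (`γ_l = 1`);
* `hubbardTTPrime_localHamiltonian_commutator_fermionEmbed_eq` — LOCALITY of the commutator between
  regions: for `Λ ⊆ Λ'` with `thicken Λ 1 ⊆ Λ'`, `[H^{tt'}_{Λ'}, Γ_{Λ⊆Λ'} B] = Γ_{Λ₁⊆Λ'} [H^{tt'}_{Λ₁}, Γ_{Λ⊆Λ₁} B]`,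
  `Λ₁ = thicken Λ 1` (the region form of `hubbardTorusTT'_commutator_fermionEmbed`); hence the
  ground-state hypothesis of `FermionGroundStatesMinimiseMeanEnergy.lean` §3 (local
  `(H^{tt'}_{Λ₁} − μ_c N_{Λ₁})`-stability) gives the eom rows in every such window
  (`expect_commutator_localHamiltonian_eq_zero_of_thicken_subset`);
* `InfVolFermionState.re_expect_ge_of_window_certificate_TT'_ineq_of_groundState` — **the window
  certificate bounds every TRANSLATION-INVARIANT GROUND STATE of `H(t,t',U) − μ_c N`**: for `ω`
  translation invariant and locally `(H^{tt'}_{Λ₁} − μ_c N_{Λ₁})`-stable on every region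
  (Bratteli–Robinson's ground-state condition), `U ≥ 0`, `0 < ρ(ω) < 2`, a certified bound
  `energyDensityTT' t t' U ρ(ω) ≤ u`, `κ ≥ 0`, a translation-reduced certificate (`γ_l = 1`) with
  particle-number-conserving eom generators `B_k`, and `ω` vanishing on the certificate's charged
  words (its `U(1) × U(1)` caveat, kept as a hypothesis):
  `c − Σₖ‖aₖ‖ + Σ_σ μ_σ (Re ω(n_{0σ}) − ν) ≤ Re ω_{Λ'}(X)` — by the previous items and
  `meanEnergy_eq_energyDensityTT'_of_groundState` (`e^{tt'}(ω) = e(ρ(ω)) ≤ u`).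

Sources: J. Wang et al., PRX 14 (2024) 031006 §III (energy-constrained relaxation: every state of
energy `≤ E_up` satisfying the constraints obeys the certified bound) [WangEtAl2024]; X. Han,
arXiv:2006.06002 §3 (the square-lattice constraint set: positivity, `⟨[H,O]⟩ = 0`, symmetry,
charge) [Han2020Bootstrap]; Bratteli–Kishimoto–Robinson 1978 Thm. 2 and Bratteli–Robinson II
Prop. 5.3.19 for the ground-state input (via `FermionGroundStatesMinimiseMeanEnergy.lean`).
Everything is PROVED; no definition, no named fact.
-/

noncomputable section

namespace Literature.MathematicalPhysics.QuantumLattice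

open Matrix Finset HubbardWave0 Literature.Probability.LatticeModels ThermodynamicLimit
open Literature.MathematicalPhysics.QuantumManyBody.StateRelaxation
open scoped ComplexOrder

/-! ### Residual words and anti-Hermitian parts in an abstract state -/

section Words

variable {ι : Type*} [LinearOrder ι] [Fintype ι]

open scoped Matrix.Norms.L2Operator in
/-- A ladder word `a₁ ⋯ aₖ` (each `aᵢ` a `c` or a `c†`) has operator norm `≤ 1`.
[cite: BratteliRobinsonII1997, §5.2.2 (‖a(f)‖ = ‖f‖)] -/
theorem norm_ladderWord_le_one (l : List (ι × Bool)) :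
    ‖(ladderWord l : Matrix (Finset ι) (Finset ι) ℂ)‖ ≤ 1 := by
  induction l with
  | nil =>
    rw [ladderWord_nil]
    have h := Matrix.l2_opNorm_conjTranspose_mul_self (1 : Matrix (Finset ι) (Finset ι) ℂ)
    rw [Matrix.conjTranspose_one, Matrix.mul_one] at h
    nlinarith [norm_nonneg (1 : Matrix (Finset ι) (Finset ι) ℂ)]
  | cons p l ih =>
    rw [ladderWord_cons]
    have hp : ‖(ladderLetter p : Matrix (Finset ι) (Finset ι) ℂ)‖ ≤ 1 := by
      unfold ladderLetter
      split_ifs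
      · exact norm_creation_le_one _
      · exact norm_annihilation_le_one _
    calc _ ≤ ‖(ladderLetter p : Matrix (Finset ι) (Finset ι) ℂ)‖ * ‖(ladderWord l : Matrix (Finset ι) (Finset ι) ℂ)‖ :=
          norm_mul_le _ _
      _ ≤ 1 * 1 := mul_le_mul hp ih (norm_nonneg _) zero_le_one
      _ = 1 := one_mul 1

end Words

namespace InfVolFermionState

variable {d : ℕ} (ω : InfVolFermionState d)

open scoped Matrix.Norms.L2Operator in
/-- **Residual words cost at most their coefficients**: `−‖a‖ ≤ Re (a · ω_Λ(W))` for a ladder word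
`W` (`‖ω_Λ(W)‖ ≤ ‖W‖ ≤ 1`). [cite: BratteliRobinsonI1987, Prop. 2.3.11] -/
theorem neg_norm_le_re_mul_expect_ladderWord (Λ : Finset (Site d)) (a : ℂ)
    (l : List (Orb (PolySite Λ) × Bool)) :
    -‖a‖ ≤ (a * ω.expect Λ (ladderWord l)).re := by
  have h1 : ‖ω.expect Λ (ladderWord l)‖ ≤ 1 :=
    (ω.norm_expect_le Λ _).trans (norm_ladderWord_le_one l)
  have h2 : ‖a * ω.expect Λ (ladderWord l)‖ ≤ ‖a‖ := by
    rw [norm_mul]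
    exact mul_le_of_le_one_right (norm_nonneg a) h1
  have h3 := (abs_le.1 ((Complex.abs_re_le_norm _).trans h2)).1
  exact h3

/-- The anti-Hermitian part `Vᴴ − V` has purely imaginary expectation: `Re (d · ω(Vᴴ − V)) = 0`
for real `d`. [cite: BratteliRobinsonI1987, §2.3.2] -/
theorem re_ofReal_mul_expect_conjTranspose_sub_self (Λ : Finset (Site d)) (dc : ℝ) (V : FermionOp Λ) :
    (((dc : ℝ) : ℂ) * ω.expect Λ (Vᴴ - V)).re = 0 := by
  rw [map_sub, ω.expect_conjTranspose, Complex.re_ofReal_mul, Complex.sub_re, Complex.star_def,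
    Complex.conj_re, sub_self, mul_zero]

end InfVolFermionState

/-! ### The window certificate in an abstract state -/

namespace InfVolFermionState

/-- **The `t–t'` window certificate read in an ABSTRACT infinite-volume state.** Let the certificate
identity of `re_orbitState_ge_of_window_certificate_d4_TT'_ineq` hold in `𝔄_{Λ'}` (objective `Xw`,
density multipliers `μ_σ` at the origin, energy-constraint term `κ (u·1 − Γ E^{tt'}_Φ)`, Gram part
`Σ Λₐᵦ Oₐᴴ O_b` with `Λm ⪰ 0`, rows `H^{tt'}_{Λ'} ΓBₖ − ΓBₖ H^{tt'}_{Λ'}`, defects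
`Γ(d4Emb γₗ wₗ) Yₗ − Γ Yₗ`, charged words `bⱼ Wⱼ`, anti-Hermitian parts `dₘ(Vₘᴴ − Vₘ)`, residual
words `aₖ Wₖ`). If a state `ω` of the lattice fermions on `ℤ²` kills the rows, the defects and the
charged words of the certificate, then
`c − Σₖ ‖aₖ‖ + Σ_σ μ_σ (Re ω_{Λ'}(n_{0σ}) − ν) + κ (u − e^{tt'}(ω)) ≤ Re ω_{Λ'}(Xw)`,
`e^{tt'}(ω) = ω.meanEnergy (hubbardTTPrimeFermionInteraction t t' U) 1`. (Apply `ω_{Λ'}` to the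
identity: the Gram part is `≥ 0` by positivity, the anti-Hermitian parts are purely imaginary, the
residual words are contractions.) Wang et al. 2024 §III; Han 2020 §3. [cite: WangEtAl2024, §III] -/
theorem re_expect_ge_of_window_certificate_TT'_ineq_of_nulls (ω : InfVolFermionState 2) (t t' U : ℝ)
    {Λ Λ' : Finset (Site 2)} (hΛ : Λ ⊆ Λ')
    (h0 : thicken ({0} : Finset (Site 2)) 1 ⊆ Λ') (hz : (0 : Site 2) ∈ Λ')
    (Xw : FermionOp Λ') (κ u : ℝ) (μ : Fin 2 → ℝ) (ν : ℝ)
    {m : Type*} [Fintype m] [DecidableEq m] {Λm : Matrix m m ℂ} (hΛm : Λm.PosSemidef)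
    (O : m → FermionOp Λ')
    {κ' : Type*} (s : Finset κ') (B : κ' → FermionOp Λ)
    {ι : Type*} (tt : Finset ι) (γ : ι → DihedralGroup 4) (wv : ι → Site 2)
    (hsh : ∀ l, d4ShiftSet (γ l) (wv l) Λ ⊆ Λ') (Y : ι → FermionOp Λ)
    {ρ : Type*} (uu : Finset ρ) (b : ρ → ℂ) (cw : ρ → List (Orb (PolySite Λ') × Bool))
    {δ : Type*} (ah : Finset δ) (dc : δ → ℝ) (V : δ → FermionOp Λ')
    {κ'' : Type*} (w : Finset κ'') (a : κ'' → ℂ) (word : κ'' → List (Orb (PolySite Λ') × Bool)) {c : ℝ}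
    (hcert : Xw - (c : ℂ) • (1 : FermionOp Λ') -
        ∑ σ : Fin 2, ((μ σ : ℝ) : ℂ) • (nAt 0 hz σ - ((ν : ℝ) : ℂ) • (1 : FermionOp Λ')) -
        ((κ : ℝ) : ℂ) • (((u : ℝ) : ℂ) • (1 : FermionOp Λ') -
          fermionEmbed (PolySite.incl h0) ((hubbardTTPrimeFermionInteraction t t' U).meanEnergyObs 1)) =
      gramForm Λm O +
        (∑ k ∈ s, ((hubbardTTPrimeFermionInteraction t t' U).localHamiltonian Λ' * fermionEmbed (PolySite.incl hΛ) (B k) -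
            fermionEmbed (PolySite.incl hΛ) (B k) * (hubbardTTPrimeFermionInteraction t t' U).localHamiltonian Λ') +
          ∑ l ∈ tt, (fermionEmbed (PolySite.incl (hsh l)) (fermionEmbed (PolySite.d4Emb (γ l) (wv l) Λ) (Y l)) -
            fermionEmbed (PolySite.incl hΛ) (Y l)) +
          ∑ j ∈ uu, b j • ladderWord (cw j)) +
        (∑ m' ∈ ah, ((dc m' : ℝ) : ℂ) • ((V m')ᴴ - V m') + ∑ k ∈ w, a k • ladderWord (word k)))
    (heom : ∀ k ∈ s, ω.expect Λ'
        ((hubbardTTPrimeFermionInteraction t t' U).localHamiltonian Λ' * fermionEmbed (PolySite.incl hΛ) (B k) -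
          fermionEmbed (PolySite.incl hΛ) (B k) * (hubbardTTPrimeFermionInteraction t t' U).localHamiltonian Λ') = 0)
    (hsym : ∀ l ∈ tt, ω.expect Λ'
        (fermionEmbed (PolySite.incl (hsh l)) (fermionEmbed (PolySite.d4Emb (γ l) (wv l) Λ) (Y l)) -
          fermionEmbed (PolySite.incl hΛ) (Y l)) = 0)
    (hch : ∀ j ∈ uu, ω.expect Λ' (ladderWord (cw j)) = 0) :
    c - ∑ k ∈ w, ‖a k‖ + ∑ σ : Fin 2, μ σ * ((ω.expect Λ' (nAt 0 hz σ)).re - ν) +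
        κ * (u - ω.meanEnergy (hubbardTTPrimeFermionInteraction t t' U) 1) ≤
      (ω.expect Λ' Xw).re := by
  -- the positive functional `ω_{Λ'}`
  have hpos : ∀ A : FermionOp Λ', 0 ≤ ω.expect Λ' (star A * A) := fun A => by
    rw [Matrix.star_eq_conjTranspose]
    exact ω.expect_nonneg Λ' A
  -- the null rows
  have hn : ω.expect Λ'
      (∑ k ∈ s, ((hubbardTTPrimeFermionInteraction t t' U).localHamiltonian Λ' * fermionEmbed (PolySite.incl hΛ) (B k) -
          fermionEmbed (PolySite.incl hΛ) (B k) * (hubbardTTPrimeFermionInteraction t t' U).localHamiltonian Λ') +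
        ∑ l ∈ tt, (fermionEmbed (PolySite.incl (hsh l)) (fermionEmbed (PolySite.d4Emb (γ l) (wv l) Λ) (Y l)) -
          fermionEmbed (PolySite.incl hΛ) (Y l)) +
        ∑ j ∈ uu, b j • ladderWord (cw j)) = 0 := by
    rw [map_add, map_add, map_sum, map_sum, map_sum, Finset.sum_eq_zero heom, Finset.sum_eq_zero hsym,
      Finset.sum_eq_zero (fun j hj => by rw [map_smul, hch j hj, smul_zero]), add_zero, add_zero]
  -- the residual
  have hah : (ω.expect Λ' (∑ m' ∈ ah, ((dc m' : ℝ) : ℂ) • ((V m')ᴴ - V m'))).re = 0 := by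
    rw [map_sum, Complex.re_sum]
    refine Finset.sum_eq_zero fun m' _ => ?_
    rw [map_smul, smul_eq_mul]
    exact ω.re_ofReal_mul_expect_conjTranspose_sub_self Λ' (dc m') (V m')
  have hr : -(∑ k ∈ w, ‖a k‖) ≤ (ω.expect Λ'
      (∑ m' ∈ ah, ((dc m' : ℝ) : ℂ) • ((V m')ᴴ - V m') + ∑ k ∈ w, a k • ladderWord (word k))).re := by
    rw [map_add, Complex.add_re, hah, zero_add]
    exact neg_sum_norm_le_re_map_sum w (ω.expect Λ') a (fun k => ladderWord (word k))
      fun k _ => ω.neg_norm_le_re_mul_expect_ladderWord Λ' (a k) (word k)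
  have hcert' : (Xw - ∑ σ : Fin 2, ((μ σ : ℝ) : ℂ) • (nAt 0 hz σ - ((ν : ℝ) : ℂ) • (1 : FermionOp Λ')) -
        ((κ : ℝ) : ℂ) • (((u : ℝ) : ℂ) • (1 : FermionOp Λ') -
          fermionEmbed (PolySite.incl h0) ((hubbardTTPrimeFermionInteraction t t' U).meanEnergyObs 1))) -
        (c : ℂ) • (1 : FermionOp Λ') =
      gramForm Λm O +
        (∑ k ∈ s, ((hubbardTTPrimeFermionInteraction t t' U).localHamiltonian Λ' * fermionEmbed (PolySite.incl hΛ) (B k) -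
            fermionEmbed (PolySite.incl hΛ) (B k) * (hubbardTTPrimeFermionInteraction t t' U).localHamiltonian Λ') +
          ∑ l ∈ tt, (fermionEmbed (PolySite.incl (hsh l)) (fermionEmbed (PolySite.d4Emb (γ l) (wv l) Λ) (Y l)) -
            fermionEmbed (PolySite.incl hΛ) (Y l)) +
          ∑ j ∈ uu, b j • ladderWord (cw j)) +
        (∑ m' ∈ ah, ((dc m' : ℝ) : ℂ) • ((V m')ᴴ - V m') + ∑ k ∈ w, a k • ladderWord (word k)) := by
    rw [← hcert]
    abel
  have hmain := le_re_map_of_certificate_residual (ω.expect Λ') hpos (ω.expect_one Λ') hΛm O hn hr hcert'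
  -- read the left-hand side
  have hlhs : (ω.expect Λ' (Xw -
        ∑ σ : Fin 2, ((μ σ : ℝ) : ℂ) • (nAt 0 hz σ - ((ν : ℝ) : ℂ) • (1 : FermionOp Λ')) -
        ((κ : ℝ) : ℂ) • (((u : ℝ) : ℂ) • (1 : FermionOp Λ') -
          fermionEmbed (PolySite.incl h0) ((hubbardTTPrimeFermionInteraction t t' U).meanEnergyObs 1)))).re =
      (ω.expect Λ' Xw).re - ∑ σ : Fin 2, μ σ * ((ω.expect Λ' (nAt 0 hz σ)).re - ν) -
        κ * (u - ω.meanEnergy (hubbardTTPrimeFermionInteraction t t' U) 1) := by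
    rw [map_sub, map_sub, Complex.sub_re, Complex.sub_re, map_sum, Complex.re_sum, map_smul, smul_eq_mul,
      Complex.re_ofReal_mul, map_sub, map_smul, ω.expect_one, Complex.sub_re, smul_eq_mul, mul_one,
      Complex.ofReal_re, ω.compatible h0, InfVolFermionState.meanEnergy]
    congr 2
    refine Finset.sum_congr rfl fun σ _ => ?_
    rw [map_smul, smul_eq_mul, Complex.re_ofReal_mul, map_sub, map_smul, ω.expect_one, Complex.sub_re,
      smul_eq_mul, mul_one, Complex.ofReal_re]
  rw [hlhs] at hmain
  linarith

/-! ### Translation-invariant states kill the translation defects -/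

/-- The translated region `1·Λ + w` of the affine `D₄` formalism is the translate `Λ + w`. [folklore] -/
private theorem shiftSet_subset_d4ShiftSet_one (w : Site 2) (Λ : Finset (Site 2)) :
    shiftSet w Λ ⊆ d4ShiftSet 1 w Λ := by
  intro x hx
  rw [mem_shiftSet] at hx
  have h := d4Vec_add_mem_d4ShiftSet (1 : DihedralGroup 4) w hx
  rwa [d4Vec_one, sub_add_cancel] at h

/-- **A translation-invariant state kills the translation defects of a certificate**: for `γ = 1`,
`ω_{Λ'}(Γ(incl)(Γ(d4Emb 1 w Λ) Y)) = ω_{Λ'}(Γ(incl) Y)` (both equal `ω_Λ(Y)`, the first through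
`ω ∘ τ_w = ω`). [cite: ArakiMoriya2003, §4.1 Def. 4.5] -/
theorem IsTranslationInvariant.expect_translationDefect_eq_zero {ω : InfVolFermionState 2}
    (hω : ω.IsTranslationInvariant) {Λ Λ' : Finset (Site 2)} (hΛ : Λ ⊆ Λ') (w : Site 2)
    (hsh : d4ShiftSet 1 w Λ ⊆ Λ') (Y : FermionOp Λ) :
    ω.expect Λ' (fermionEmbed (PolySite.incl hsh) (fermionEmbed (PolySite.d4Emb 1 w Λ) Y) -
      fermionEmbed (PolySite.incl hΛ) Y) = 0 := by
  rw [map_sub, ω.compatible hΛ, ω.compatible hsh, sub_eq_zero]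
  -- `Γ(d4Emb 1 w Λ) = Γ(incl) ∘ Γ(shiftEmb w Λ)` into the region `1·Λ + w ⊇ Λ + w`
  have hemb : fermionEmbed (PolySite.d4Emb 1 w Λ) Y =
      fermionEmbed (PolySite.incl (shiftSet_subset_d4ShiftSet_one w Λ)) (fermionEmbed (PolySite.shiftEmb w Λ) Y) := by
    rw [fermionEmbed_fermionEmbed]
    refine congrFun (congrArg DFunLike.coe (fermionEmbed_congr fun y => Subtype.ext ?_)) Y
    show toLex (d4Vec 1 (ofLex y.1) + w) = toLex (ofLex y.1 + w)
    rw [d4Vec_one]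
  rw [hemb, ω.compatible, ← shift_expect, hω w]

end InfVolFermionState

/-! ### Locality of the commutator between regions -/

section Locality

variable (t t' U : ℝ)

/-- A term of the `t–t'` interaction inside `Λ'` but NOT inside `thicken Λ 1` does not meet `Λ`
(its support is a site, a nearest-neighbour bond or a diagonal bond, and `thicken Λ 1` contains all
eight neighbours of every site of `Λ`), hence it commutes with every observable of `Λ`.
[cite: BratteliRobinsonII1997, Thm. 6.2.4 (proof)] -/
theorem commute_fermionEmbed_hubbardTTPrime_apply_of_not_subset_thicken {X Λ Λ' : Finset (Site 2)}
    (hX : X ⊆ Λ') (hΛ : Λ ⊆ Λ') (hXt : ¬ X ⊆ thicken Λ 1) (A : FermionOp Λ) :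
    Commute (fermionEmbed (PolySite.incl hX) ((hubbardTTPrimeFermionInteraction t t' U).Φ X))
      (fermionEmbed (PolySite.incl hΛ) A) := by
  by_cases hΦ : (hubbardTTPrimeFermionInteraction t t' U).Φ X = 0
  · rw [hΦ, map_zero]
    exact Commute.zero_left _
  refine (hubbardTTPrimeFermionInteraction t t' U).commute_fermionEmbed_apply_of_disjoint
    (hubbardTTPrimeFermionInteraction_isEven t t' U) hX hΛ ?_ A
  -- the support of a nonzero term, and why it misses `Λ`
  by_contra hd
  refine hΦ (hubbardTTPrimeFermionInteraction_apply_eq_zero t t' U (fun z hz => ?_) (fun z i hz => ?_)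
    (fun z s' hz => ?_))
  · subst hz
    rw [Finset.disjoint_singleton_left, not_not] at hd
    exact hXt (Finset.singleton_subset_iff.2 (subset_thicken Λ 1 hd))
  · subst hz
    rw [Finset.not_disjoint_iff] at hd
    obtain ⟨y, hy, hyΛ⟩ := hd
    rw [Finset.mem_insert, Finset.mem_singleton] at hy
    refine hXt (Finset.insert_subset_iff.2 ⟨?_, Finset.singleton_subset_iff.2 ?_⟩)
    · rcases hy with rfl | rfl
      · exact subset_thicken Λ 1 hyΛ
      · have h := sub_unitVec_mem_thicken_one hyΛ i
        rwa [add_sub_cancel_right] at h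
    · rcases hy with rfl | rfl
      · exact add_unitVec_mem_thicken_one hyΛ i
      · exact subset_thicken Λ 1 hyΛ
  · subst hz
    rw [Finset.not_disjoint_iff] at hd
    obtain ⟨y, hy, hyΛ⟩ := hd
    rw [Finset.mem_insert, Finset.mem_singleton] at hy
    refine hXt (Finset.insert_subset_iff.2 ⟨?_, Finset.singleton_subset_iff.2 ?_⟩)
    · rcases hy with rfl | rfl
      · exact subset_thicken Λ 1 hyΛ
      · have h := sub_diagVec_mem_thicken_one hyΛ s'
        rwa [add_sub_cancel_right] at h
    · rcases hy with rfl | rfl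
      · exact add_diagVec_mem_thicken_one hyΛ s'
      · exact subset_thicken Λ 1 hyΛ

/-- **Locality of the commutator with the local Hamiltonian, region form**: for `Λ ⊆ Λ'` with
`thicken Λ 1 ⊆ Λ'` and `B ∈ 𝔄_Λ`,
`H^{tt'}_{Λ'} Γ_{Λ⊆Λ'}B − Γ_{Λ⊆Λ'}B H^{tt'}_{Λ'} = Γ_{Λ₁⊆Λ'}(H^{tt'}_{Λ₁} Γ_{Λ⊆Λ₁}B − Γ_{Λ⊆Λ₁}B H^{tt'}_{Λ₁})`,
`Λ₁ = thicken Λ 1` — the terms of `H^{tt'}_{Λ'}` outside `Λ₁` commute with `𝔄_Λ` (Bratteli–Robinson II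
Thm. 6.2.4: `δ(A) = i[H_{Λ'}, A]` for every `Λ'` containing the range-neighbourhood of the support).
[cite: BratteliRobinsonII1997, Thm. 6.2.4] -/
theorem hubbardTTPrime_localHamiltonian_commutator_fermionEmbed_eq {Λ Λ' : Finset (Site 2)} (hΛ : Λ ⊆ Λ')
    (h8 : thicken Λ 1 ⊆ Λ') (B : FermionOp Λ) :
    (hubbardTTPrimeFermionInteraction t t' U).localHamiltonian Λ' * fermionEmbed (PolySite.incl hΛ) B -
        fermionEmbed (PolySite.incl hΛ) B * (hubbardTTPrimeFermionInteraction t t' U).localHamiltonian Λ' =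
      fermionEmbed (PolySite.incl h8)
        ((hubbardTTPrimeFermionInteraction t t' U).localHamiltonian (thicken Λ 1) *
            fermionEmbed (PolySite.incl (subset_thicken Λ 1)) B -
          fermionEmbed (PolySite.incl (subset_thicken Λ 1)) B *
            (hubbardTTPrimeFermionInteraction t t' U).localHamiltonian (thicken Λ 1)) := by
  have hB : fermionEmbed (PolySite.incl hΛ) B =
      fermionEmbed (PolySite.incl h8) (fermionEmbed (PolySite.incl (subset_thicken Λ 1)) B) := by
    rw [fermionEmbed_fermionEmbed, PolySite.incl_trans]
  -- the terms of `H_{Λ'}` outside `Λ₁` commute with `Γ B`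
  have hrest : Commute
      ((∑ X ∈ Λ'.powerset with (¬ X ⊆ thicken Λ 1 ∧ Disjoint X (thicken Λ 1)),
          (if h : X ⊆ Λ' then fermionEmbed (PolySite.incl h) ((hubbardTTPrimeFermionInteraction t t' U).Φ X) else 0)) +
        (∑ X ∈ Λ'.powerset with (¬ X ⊆ thicken Λ 1 ∧ ¬ Disjoint X (thicken Λ 1)),
          (if h : X ⊆ Λ' then fermionEmbed (PolySite.incl h) ((hubbardTTPrimeFermionInteraction t t' U).Φ X) else 0)))
      (fermionEmbed (PolySite.incl hΛ) B) := by
    refine Commute.add_left (Commute.sum_left _ _ _ fun X hX => ?_) (Commute.sum_left _ _ _ fun X hX => ?_)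
    · rw [Finset.mem_filter, Finset.mem_powerset] at hX
      rw [dif_pos hX.1]
      exact commute_fermionEmbed_hubbardTTPrime_apply_of_not_subset_thicken t t' U hX.1 hΛ hX.2.1 B
    · rw [Finset.mem_filter, Finset.mem_powerset] at hX
      rw [dif_pos hX.1]
      exact commute_fermionEmbed_hubbardTTPrime_apply_of_not_subset_thicken t t' U hX.1 hΛ hX.2.1 B
  rw [(hubbardTTPrimeFermionInteraction t t' U).localHamiltonian_eq_fermionEmbed_add_far_add_cross h8, add_assoc,
    Matrix.add_mul, Matrix.mul_add, hrest.eq, add_sub_add_right_eq_sub, hB, ← map_mul, ← map_mul, ← map_sub]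

/-- The same locality for the particle number: `N_{Λ'} Γ_{Λ⊆Λ'}B − Γ_{Λ⊆Λ'}B N_{Λ'} = Γ_{Λ₁⊆Λ'}(N_{Λ₁} ΓB − ΓB N_{Λ₁})`
for every `Λ ⊆ Λ₁ ⊆ Λ'`. [cite: BratteliRobinsonII1997, §6.2.1] -/
theorem totalNumber_commutator_fermionEmbed_eq {d : ℕ} {Λ Λ₁ Λ' : Finset (Site d)} (h1 : Λ ⊆ Λ₁) (h8 : Λ₁ ⊆ Λ')
    (B : FermionOp Λ) :
    (totalNumber : FermionOp Λ') * fermionEmbed (PolySite.incl (h1.trans h8)) B -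
        fermionEmbed (PolySite.incl (h1.trans h8)) B * (totalNumber : FermionOp Λ') =
      fermionEmbed (PolySite.incl h8)
        ((totalNumber : FermionOp Λ₁) * fermionEmbed (PolySite.incl h1) B -
          fermionEmbed (PolySite.incl h1) B * (totalNumber : FermionOp Λ₁)) := by
  have hB : fermionEmbed (PolySite.incl (h1.trans h8)) B =
      fermionEmbed (PolySite.incl h8) (fermionEmbed (PolySite.incl h1) B) := by
    rw [fermionEmbed_fermionEmbed, PolySite.incl_trans]
  have hrest := commute_outsideNumber_fermionEmbed h8 (fermionEmbed (PolySite.incl h1) B)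
  rw [← hB] at hrest
  rw [totalNumber_eq_fermionEmbed_add_sum h8, Matrix.add_mul, Matrix.mul_add, hrest.eq, add_sub_add_right_eq_sub, hB,
    ← map_mul, ← map_mul, ← map_sub]

end Locality

/-! ### Ground states of `H(t,t',U) - μ_c N` in an arbitrary window -/

namespace InfVolFermionState

section GroundStateWindow

variable {ω : InfVolFermionState 2} {t t' U μc : ℝ}
variable (hgs : ∀ (Λ : Finset (Site 2)) (A : FermionOp Λ),
    0 ≤ (ω.expect (thicken Λ 1)
      ((fermionEmbed (PolySite.incl (subset_thicken Λ 1)) A)ᴴ *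
        (((hubbardTTPrimeFermionInteraction t t' U).localHamiltonian (thicken Λ 1) -
              (μc : ℂ) • (totalNumber : FermionOp (thicken Λ 1))) *
            fermionEmbed (PolySite.incl (subset_thicken Λ 1)) A -
          fermionEmbed (PolySite.incl (subset_thicken Λ 1)) A *
            ((hubbardTTPrimeFermionInteraction t t' U).localHamiltonian (thicken Λ 1) -
              (μc : ℂ) • (totalNumber : FermionOp (thicken Λ 1)))))).re)

include hgs in
/-- **The eom rows hold in every window**: under the ground-state hypothesis for `H(t,t',U) − μ_c N`,
for `Λ ⊆ Λ'` with `thicken Λ 1 ⊆ Λ'` and every particle-number-conserving `B ∈ 𝔄_Λ`,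
`ω_{Λ'}(H^{tt'}_{Λ'} ΓB − ΓB H^{tt'}_{Λ'}) = 0`. [cite: BratteliRobinsonII1997, Prop. 5.3.19] -/
theorem expect_commutator_localHamiltonian_eq_zero_of_thicken_subset {Λ Λ' : Finset (Site 2)}
    (hΛ : Λ ⊆ Λ') (h8 : thicken Λ 1 ⊆ Λ') {B : FermionOp Λ} (hB : Commute B (totalNumber : FermionOp Λ)) :
    ω.expect Λ'
      ((hubbardTTPrimeFermionInteraction t t' U).localHamiltonian Λ' * fermionEmbed (PolySite.incl hΛ) B -
        fermionEmbed (PolySite.incl hΛ) B * (hubbardTTPrimeFermionInteraction t t' U).localHamiltonian Λ') = 0 := by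
  rw [hubbardTTPrime_localHamiltonian_commutator_fermionEmbed_eq t t' U hΛ h8, ω.compatible h8]
  exact expect_commutator_localHamiltonian_eq_zero_of_commute hgs Λ hB

include hgs in
/-- **The `t–t'` window certificate bounds every translation-invariant ground state of
`H(t,t',U) − μ_c N`.** Let `ω` be translation invariant and locally `(H^{tt'}_{Λ₁} − μ_c N_{Λ₁})`-stable
on every finite region (the Bratteli–Robinson ground-state condition for the dynamics of `H − μ_c N`),
with `U ≥ 0`, `0 < ρ(ω) < 2`, and let `u` be a certified upper bound `energyDensityTT' t t' U ρ(ω) ≤ u`.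
Then every TRANSLATION-reduced window certificate (the identity of
`re_expect_ge_of_window_certificate_TT'_ineq_of_nulls` with all `γₗ = 1`, `thicken Λ 1 ⊆ Λ'`, `κ ≥ 0`)
whose eom generators `Bₖ` conserve the particle number, and on whose charged words `ω` vanishes,
proves `c − Σₖ ‖aₖ‖ + Σ_σ μ_σ (Re ω_{Λ'}(n_{0σ}) − ν) ≤ Re ω_{Λ'}(Xw)`: the rows hold by stationarity
(`expect_commutator_localHamiltonian_eq_zero_of_thicken_subset`), the translation defects by
invariance, and the energy constraint by `e^{tt'}(ω) = energyDensityTT' t t' U ρ(ω) ≤ u`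
(`meanEnergy_eq_energyDensityTT'_of_groundState`). Wang et al. 2024 §III (every state below the
energy cap satisfying the constraints obeys the bound), for the class of translation-invariant
ground states (Bratteli–Kishimoto–Robinson 1978 Thm. 2). [cite: WangEtAl2024, §III] -/
theorem re_expect_ge_of_window_certificate_TT'_ineq_of_groundState (hω : ω.IsTranslationInvariant)
    (hU : 0 ≤ U) (hρ0 : 0 < ω.density) (hρ2 : ω.density < 2)
    {Λ Λ' : Finset (Site 2)} (hΛ : Λ ⊆ Λ') (h8 : thicken Λ 1 ⊆ Λ')
    (h0 : thicken ({0} : Finset (Site 2)) 1 ⊆ Λ') (hz : (0 : Site 2) ∈ Λ')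
    (Xw : FermionOp Λ') {κ u : ℝ} (hκ : 0 ≤ κ) (hu : energyDensityTT' t t' U ω.density ≤ u)
    (μ : Fin 2 → ℝ) (ν : ℝ)
    {m : Type*} [Fintype m] [DecidableEq m] {Λm : Matrix m m ℂ} (hΛm : Λm.PosSemidef)
    (O : m → FermionOp Λ')
    {κ' : Type*} (s : Finset κ') (B : κ' → FermionOp Λ) (hB : ∀ k ∈ s, Commute (B k) (totalNumber : FermionOp Λ))
    {ι : Type*} (tt : Finset ι) (γ : ι → DihedralGroup 4) (hγ : ∀ l ∈ tt, γ l = 1) (wv : ι → Site 2)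
    (hsh : ∀ l, d4ShiftSet (γ l) (wv l) Λ ⊆ Λ') (Y : ι → FermionOp Λ)
    {ρ : Type*} (uu : Finset ρ) (b : ρ → ℂ) (cw : ρ → List (Orb (PolySite Λ') × Bool))
    (hch : ∀ j ∈ uu, ω.expect Λ' (ladderWord (cw j)) = 0)
    {δ : Type*} (ah : Finset δ) (dc : δ → ℝ) (V : δ → FermionOp Λ')
    {κ'' : Type*} (w : Finset κ'') (a : κ'' → ℂ) (word : κ'' → List (Orb (PolySite Λ') × Bool)) {c : ℝ}
    (hcert : Xw - (c : ℂ) • (1 : FermionOp Λ') -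
        ∑ σ : Fin 2, ((μ σ : ℝ) : ℂ) • (nAt 0 hz σ - ((ν : ℝ) : ℂ) • (1 : FermionOp Λ')) -
        ((κ : ℝ) : ℂ) • (((u : ℝ) : ℂ) • (1 : FermionOp Λ') -
          fermionEmbed (PolySite.incl h0) ((hubbardTTPrimeFermionInteraction t t' U).meanEnergyObs 1)) =
      gramForm Λm O +
        (∑ k ∈ s, ((hubbardTTPrimeFermionInteraction t t' U).localHamiltonian Λ' * fermionEmbed (PolySite.incl hΛ) (B k) -
            fermionEmbed (PolySite.incl hΛ) (B k) * (hubbardTTPrimeFermionInteraction t t' U).localHamiltonian Λ') +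
          ∑ l ∈ tt, (fermionEmbed (PolySite.incl (hsh l)) (fermionEmbed (PolySite.d4Emb (γ l) (wv l) Λ) (Y l)) -
            fermionEmbed (PolySite.incl hΛ) (Y l)) +
          ∑ j ∈ uu, b j • ladderWord (cw j)) +
        (∑ m' ∈ ah, ((dc m' : ℝ) : ℂ) • ((V m')ᴴ - V m') + ∑ k ∈ w, a k • ladderWord (word k))) :
    c - ∑ k ∈ w, ‖a k‖ + ∑ σ : Fin 2, μ σ * ((ω.expect Λ' (nAt 0 hz σ)).re - ν) ≤ (ω.expect Λ' Xw).re := by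
  have hsym : ∀ l ∈ tt, ω.expect Λ'
      (fermionEmbed (PolySite.incl (hsh l)) (fermionEmbed (PolySite.d4Emb (γ l) (wv l) Λ) (Y l)) -
        fermionEmbed (PolySite.incl hΛ) (Y l)) = 0 := by
    intro l hl
    have hsh1 : d4ShiftSet 1 (wv l) Λ ⊆ Λ' := by rw [← hγ l hl]; exact hsh l
    have h := hω.expect_translationDefect_eq_zero hΛ (wv l) hsh1 (Y l)
    revert h
    have : ∀ (g : DihedralGroup 4) (hg : d4ShiftSet g (wv l) Λ ⊆ Λ'), g = 1 →
        (ω.expect Λ' (fermionEmbed (PolySite.incl hg) (fermionEmbed (PolySite.d4Emb g (wv l) Λ) (Y l)) -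
          fermionEmbed (PolySite.incl hΛ) (Y l)) = 0 →
        ω.expect Λ' (fermionEmbed (PolySite.incl (hsh l)) (fermionEmbed (PolySite.d4Emb (γ l) (wv l) Λ) (Y l)) -
          fermionEmbed (PolySite.incl hΛ) (Y l)) = 0) := by
      intro g hg hg1 h
      subst hg1
      have hγ1 := hγ l hl
      revert hg h
      generalize hsh l = hshl
      revert hshl
      rw [hγ1]
      intro hshl hg h
      exact h
    exact this 1 hsh1 rfl
  have heom : ∀ k ∈ s, ω.expect Λ'
      ((hubbardTTPrimeFermionInteraction t t' U).localHamiltonian Λ' * fermionEmbed (PolySite.incl hΛ) (B k) -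
        fermionEmbed (PolySite.incl hΛ) (B k) * (hubbardTTPrimeFermionInteraction t t' U).localHamiltonian Λ') = 0 :=
    fun k hk => expect_commutator_localHamiltonian_eq_zero_of_thicken_subset hgs hΛ h8 (hB k hk)
  have h := ω.re_expect_ge_of_window_certificate_TT'_ineq_of_nulls t t' U hΛ h0 hz Xw κ u μ ν hΛm O s B tt γ wv
    hsh Y uu b cw ah dc V w a word hcert heom hsym hch
  have he : ω.meanEnergy (hubbardTTPrimeFermionInteraction t t' U) 1 = energyDensityTT' t t' U ω.density :=
    meanEnergy_eq_energyDensityTT'_of_groundState hgs hω hU hρ0 hρ2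
  rw [he] at h
  nlinarith [mul_nonneg hκ (sub_nonneg.2 hu)]

include hgs in
/-- **The eom rows hold for every generator whose number commutator is `ω`-null**: under the
ground-state hypothesis for `H(t,t',U) − μ_c N`, for `Λ ⊆ Λ'` with `thicken Λ 1 ⊆ Λ'` and every
`B ∈ 𝔄_Λ` with `ω_Λ(N_Λ B − B N_Λ) = 0` — e.g. `B` particle-number conserving, or `B` a charged word on
which `ω` vanishes (`N_Λ B − B N_Λ = q B`) — `ω_{Λ'}(H^{tt'}_{Λ'} ΓB − ΓB H^{tt'}_{Λ'}) = 0`, because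
`ω([H − μ_c N, ΓB]) = 0` (stationarity) and `ω([N, ΓB]) = ω_Λ([N_Λ, B])`. Generalises
`expect_commutator_localHamiltonian_eq_zero_of_thicken_subset`. [cite: BratteliRobinsonII1997, Prop. 5.3.19] -/
theorem expect_commutator_localHamiltonian_eq_zero_of_expect_numberCommutator_eq_zero {Λ Λ' : Finset (Site 2)}
    (hΛ : Λ ⊆ Λ') (h8 : thicken Λ 1 ⊆ Λ') {B : FermionOp Λ}
    (hB : ω.expect Λ ((totalNumber : FermionOp Λ) * B - B * totalNumber) = 0) :
    ω.expect Λ'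
      ((hubbardTTPrimeFermionInteraction t t' U).localHamiltonian Λ' * fermionEmbed (PolySite.incl hΛ) B -
        fermionEmbed (PolySite.incl hΛ) B * (hubbardTTPrimeFermionInteraction t t' U).localHamiltonian Λ') = 0 := by
  rw [hubbardTTPrime_localHamiltonian_commutator_fermionEmbed_eq t t' U hΛ h8, ω.compatible h8]
  have h := expect_commutator_sub_smul_totalNumber_eq_zero hgs Λ B
  have hN : ω.expect (thicken Λ 1)
      ((totalNumber : FermionOp (thicken Λ 1)) * fermionEmbed (PolySite.incl (subset_thicken Λ 1)) B -
        fermionEmbed (PolySite.incl (subset_thicken Λ 1)) B * totalNumber) = 0 := by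
    have e := totalNumber_commutator_fermionEmbed_eq (subset_refl Λ) (subset_thicken Λ 1) B
    rw [PolySite.incl_rfl, fermionEmbed_refl_apply] at e
    rw [e, ω.compatible (subset_thicken Λ 1), hB]
  have hcomm : ((hubbardTTPrimeFermionInteraction t t' U).localHamiltonian (thicken Λ 1) -
            (μc : ℂ) • (totalNumber : FermionOp (thicken Λ 1))) *
          fermionEmbed (PolySite.incl (subset_thicken Λ 1)) B -
        fermionEmbed (PolySite.incl (subset_thicken Λ 1)) B *
          ((hubbardTTPrimeFermionInteraction t t' U).localHamiltonian (thicken Λ 1) -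
            (μc : ℂ) • (totalNumber : FermionOp (thicken Λ 1))) =
      ((hubbardTTPrimeFermionInteraction t t' U).localHamiltonian (thicken Λ 1) *
            fermionEmbed (PolySite.incl (subset_thicken Λ 1)) B -
          fermionEmbed (PolySite.incl (subset_thicken Λ 1)) B *
            (hubbardTTPrimeFermionInteraction t t' U).localHamiltonian (thicken Λ 1)) -
        (μc : ℂ) • ((totalNumber : FermionOp (thicken Λ 1)) * fermionEmbed (PolySite.incl (subset_thicken Λ 1)) B -
          fermionEmbed (PolySite.incl (subset_thicken Λ 1)) B * totalNumber) := by
    rw [Matrix.sub_mul, Matrix.mul_sub, Matrix.smul_mul, Matrix.mul_smul, smul_sub]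
    abel
  rw [hcomm, map_sub, map_smul, hN, smul_zero, sub_zero] at h
  exact h

include hgs in
/-- **The `t–t'` window certificate bounds every translation-invariant ground state of
`H(t,t',U) − μ_c N` — generators with `ω`-null number commutators.** As
`re_expect_ge_of_window_certificate_TT'_ineq_of_groundState`, with the hypothesis
`[Bₖ, N_Λ] = 0` on the eom generators weakened to `ω_Λ(N_Λ Bₖ − Bₖ N_Λ) = 0` (so charged words `Bₖ`
on which `ω` vanishes are admitted: every `U(1)`-gauge-invariant `ω` qualifies for every word `Bₖ`).
[cite: WangEtAl2024, §III] -/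
theorem re_expect_ge_of_window_certificate_TT'_ineq_of_groundState_of_numberCommutator_null
    (hω : ω.IsTranslationInvariant)
    (hU : 0 ≤ U) (hρ0 : 0 < ω.density) (hρ2 : ω.density < 2)
    {Λ Λ' : Finset (Site 2)} (hΛ : Λ ⊆ Λ') (h8 : thicken Λ 1 ⊆ Λ')
    (h0 : thicken ({0} : Finset (Site 2)) 1 ⊆ Λ') (hz : (0 : Site 2) ∈ Λ')
    (Xw : FermionOp Λ') {κ u : ℝ} (hκ : 0 ≤ κ) (hu : energyDensityTT' t t' U ω.density ≤ u)
    (μ : Fin 2 → ℝ) (ν : ℝ)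
    {m : Type*} [Fintype m] [DecidableEq m] {Λm : Matrix m m ℂ} (hΛm : Λm.PosSemidef)
    (O : m → FermionOp Λ')
    {κ' : Type*} (s : Finset κ') (B : κ' → FermionOp Λ)
    (hB : ∀ k ∈ s, ω.expect Λ ((totalNumber : FermionOp Λ) * B k - B k * totalNumber) = 0)
    {ι : Type*} (tt : Finset ι) (γ : ι → DihedralGroup 4) (hγ : ∀ l ∈ tt, γ l = 1) (wv : ι → Site 2)
    (hsh : ∀ l, d4ShiftSet (γ l) (wv l) Λ ⊆ Λ') (Y : ι → FermionOp Λ)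
    {ρ : Type*} (uu : Finset ρ) (b : ρ → ℂ) (cw : ρ → List (Orb (PolySite Λ') × Bool))
    (hch : ∀ j ∈ uu, ω.expect Λ' (ladderWord (cw j)) = 0)
    {δ : Type*} (ah : Finset δ) (dc : δ → ℝ) (V : δ → FermionOp Λ')
    {κ'' : Type*} (w : Finset κ'') (a : κ'' → ℂ) (word : κ'' → List (Orb (PolySite Λ') × Bool)) {c : ℝ}
    (hcert : Xw - (c : ℂ) • (1 : FermionOp Λ') -
        ∑ σ : Fin 2, ((μ σ : ℝ) : ℂ) • (nAt 0 hz σ - ((ν : ℝ) : ℂ) • (1 : FermionOp Λ')) -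
        ((κ : ℝ) : ℂ) • (((u : ℝ) : ℂ) • (1 : FermionOp Λ') -
          fermionEmbed (PolySite.incl h0) ((hubbardTTPrimeFermionInteraction t t' U).meanEnergyObs 1)) =
      gramForm Λm O +
        (∑ k ∈ s, ((hubbardTTPrimeFermionInteraction t t' U).localHamiltonian Λ' * fermionEmbed (PolySite.incl hΛ) (B k) -
            fermionEmbed (PolySite.incl hΛ) (B k) * (hubbardTTPrimeFermionInteraction t t' U).localHamiltonian Λ') +
          ∑ l ∈ tt, (fermionEmbed (PolySite.incl (hsh l)) (fermionEmbed (PolySite.d4Emb (γ l) (wv l) Λ) (Y l)) -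
            fermionEmbed (PolySite.incl hΛ) (Y l)) +
          ∑ j ∈ uu, b j • ladderWord (cw j)) +
        (∑ m' ∈ ah, ((dc m' : ℝ) : ℂ) • ((V m')ᴴ - V m') + ∑ k ∈ w, a k • ladderWord (word k))) :
    c - ∑ k ∈ w, ‖a k‖ + ∑ σ : Fin 2, μ σ * ((ω.expect Λ' (nAt 0 hz σ)).re - ν) ≤ (ω.expect Λ' Xw).re := by
  have hsym : ∀ l ∈ tt, ω.expect Λ'
      (fermionEmbed (PolySite.incl (hsh l)) (fermionEmbed (PolySite.d4Emb (γ l) (wv l) Λ) (Y l)) -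
        fermionEmbed (PolySite.incl hΛ) (Y l)) = 0 := by
    intro l hl
    have hsh1 : d4ShiftSet 1 (wv l) Λ ⊆ Λ' := by rw [← hγ l hl]; exact hsh l
    have h := hω.expect_translationDefect_eq_zero hΛ (wv l) hsh1 (Y l)
    revert h
    have : ∀ (g : DihedralGroup 4) (hg : d4ShiftSet g (wv l) Λ ⊆ Λ'), g = 1 →
        (ω.expect Λ' (fermionEmbed (PolySite.incl hg) (fermionEmbed (PolySite.d4Emb g (wv l) Λ) (Y l)) -
          fermionEmbed (PolySite.incl hΛ) (Y l)) = 0 →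
        ω.expect Λ' (fermionEmbed (PolySite.incl (hsh l)) (fermionEmbed (PolySite.d4Emb (γ l) (wv l) Λ) (Y l)) -
          fermionEmbed (PolySite.incl hΛ) (Y l)) = 0) := by
      intro g hg hg1 h
      subst hg1
      have hγ1 := hγ l hl
      revert hg h
      generalize hsh l = hshl
      revert hshl
      rw [hγ1]
      intro hshl hg h
      exact h
    exact this 1 hsh1 rfl
  have heom : ∀ k ∈ s, ω.expect Λ'
      ((hubbardTTPrimeFermionInteraction t t' U).localHamiltonian Λ' * fermionEmbed (PolySite.incl hΛ) (B k) -
        fermionEmbed (PolySite.incl hΛ) (B k) * (hubbardTTPrimeFermionInteraction t t' U).localHamiltonian Λ') = 0 :=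
    fun k hk => expect_commutator_localHamiltonian_eq_zero_of_expect_numberCommutator_eq_zero hgs hΛ h8 (hB k hk)
  have h := ω.re_expect_ge_of_window_certificate_TT'_ineq_of_nulls t t' U hΛ h0 hz Xw κ u μ ν hΛm O s B tt γ wv
    hsh Y uu b cw ah dc V w a word hcert heom hsym hch
  have he : ω.meanEnergy (hubbardTTPrimeFermionInteraction t t' U) 1 = energyDensityTT' t t' U ω.density :=
    meanEnergy_eq_energyDensityTT'_of_groundState hgs hω hU hρ0 hρ2
  rw [he] at h
  nlinarith [mul_nonneg hκ (sub_nonneg.2 hu)]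

end GroundStateWindow

end InfVolFermionState

end Literature.MathematicalPhysics.QuantumLattice

end
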